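import Summits.NavierStokesRegularity.NavierStokesRegularity.Theorems.FilamentSkeletonRssDefectColumnGateDefsRmod
import Summits.NavierStokesRegularity.NavierStokesRegularity.Theorems.FilamentSkeletonRssDefectColumnGateClosingMod
import Summits.NavierStokesRegularity.NavierStokesRegularity.Theses.FilamentSkeletonRss
import HarnessLib.Audit

/-!
# Line `defect_column_gate_1AR_mod` for the ∀-SUPPORT item `FilamentSkeletonRss.TransverseReduction1ARmod` (stmt-NavierStokesRegularity-23920; «TR-acc-NOEXPORT», R8-2 / director-ns dss_126 T1,
# filed by tenure g27 as route rev 61) — skeleton v7-mod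

LEAD ns-filament-21221-p1 g13, 2026-08-29.  Vocabulary `Theorems/FilamentSkeletonRssDefectColumnGateDefsRmod.lean` (p683304 + gauge append p684660): `BoxDef*`/`BoxClauses1R` (from `…DefsRacc`
p679981), `BoxConclMod`, `CutFormMod`, `FamilySpecMod`, `DefectGateSpecAcc` (reused), stub statements `DefectFamilyMod` (S1-mod), `DefectGateMod`/`GateAssemblyLocMod` (S2b-mod), `DefectClosingMod`
(S3-mod).  `transverseReduction1ARmod_iff : TransverseReduction1ARmod ↔ CutFormMod := Iff.rfl` (the filed text = my sig ca01b22d60adbf5c up to a transparent `let E := …` alias; byte-tested by tenure and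
idea-crit-7 01:07:40Z).  REGISTERED STUBS (v7-mod): S1-mod `stub_defectFamilyMod : DefectFamilyMod` (XL, OPEN — NO export law), S2a-loc `stub_waistColumnGateLoc1A : WaistColumnGateLoc1A`
(clause-free, UNCHANGED since v4; s2aloc lineage), S2b-mod `stub_gateAssemblyLocMod : GateAssemblyLocMod := WaistColumnGateLoc1A → DefectGateMod` (XL, OPEN, kill-first; assembly interface landed:
`defectGateSpecAcc_of_approximate` p681316).  S3-mod `stub_defectClosingMod` is PROVED (p683606) and IMPORTED, not a sorry.  Composition: `TransverseReduction1ARmod_of :=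
transverseReduction1ARmod_iff.mpr (lineGlueMod stub_defectFamilyMod (stub_gateAssemblyLocMod stub_waistColumnGateLoc1A) stub_defectClosingMod)` — the item BY NAME, three sorries.
LABELS (printed in the item's informal): T1-L1 (content = defect-forced solvability on the g-wall {g = 0}; (g off its zeros, Zr, αo) decorative) and the GAUGE `(B, Zr) ↦ (B + λg, Zr − Σλ_jD_j)`
(`noexport_gauge`): no rate-selection / export / sign meaning is to be read into (g, B); a selection statement must be gauge-invariant (T2/T3).

HONEST FRAMING.  Bookkeeping for a HYPOTHETICAL filament-type rotating-self-similar blow-up route (refutation side, MODEL rung); a SUPPORT item, not summit-live (reaches `RssProfileExists`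
only with a selection statement).  Nothing in this file moves Navier–Stokes regularity.  `lean check`: rc 0, sorries = 3 (only `stub_*`).
-/

set_option linter.dupNamespace false

noncomputable section

namespace Summit.NavierStokesRegularity.NavierStokesRegularity.Cruxes.TransverseReduction1ARmod.DefectColumnGate

open scoped BigOperators Topology InnerProductSpace ContDiff
open Filter Set Function MeasureTheory
open Literature.Analysis.FluidPDE
open Summit.NavierStokesRegularity.NavierStokesRegularity.Theses.FilamentSkeletonRss
open Summit.NavierStokesRegularity.NavierStokesRegularity.Theorems.KelvinGate (lerayOp lerayLin XBound YBound LocClose)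
open Summit.NavierStokesRegularity.NavierStokesRegularity.Theorems.DefectColumnGate

/-- **Stub S1-mod** (`DefectFamilyMod`, XL) — re-wound defect family over the box, residual split modulo the rate column and the N accretion modes, NO export law (R8), one orientation of the rate defect, joint local continuity in (p, β). -/
theorem stub_defectFamilyMod : DefectFamilyMod := by
  sorry

/-- **Stub S2a-loc** (`WaistColumnGateLoc1A`) — UNCHANGED since v4 (clause-free; s2aloc lineage's bricks). -/
theorem stub_waistColumnGateLoc1A : WaistColumnGateLoc1A := by
  sorry

/-- **Stub S2b-mod** (`GateAssemblyLocMod = WaistColumnGateLoc1A → DefectGateMod`) — patching into the gate bordered by the rate column AND the N accretion modes (R4); assembly interface `defectGateSpecAcc_of_approximate` (p681316) landed. -/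
theorem stub_gateAssemblyLocMod : GateAssemblyLocMod := by
  sorry

/-- **Stub S3-mod** (`DefectClosingMod`) — PROVED (Theorems/FilamentSkeletonRssDefectColumnGateClosingMod.lean, p683606). -/
theorem stub_defectClosingMod : DefectClosingMod :=
  Summit.NavierStokesRegularity.NavierStokesRegularity.Theorems.DefectColumnGate.stub_defectClosingMod

/-- **Glue (pure logic, no sorry)**: the three mod-stubs give the cut form. -/
theorem lineGlueMod (h1 : DefectFamilyMod) (h2 : DefectGateMod) (h3 : DefectClosingMod) : CutFormMod := by
  intro N δ ρ K Λ a b cnd η Rw Rb cg θ₀ KA hN hδ hρ ha hη hRw hRb hcg hθ₀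
  obtain ⟨Cs, hS1⟩ := h1 N δ ρ K Λ a b cnd η Rw Rb cg θ₀ KA hN hδ hρ ha hη hRw hRb hcg hθ₀
  obtain ⟨κ, C₂, q₀, k₀', hS2⟩ := h2 N δ ρ K Λ a b cnd η Rw Rb cg θ₀ KA hN hδ hρ ha hη hRw hRb hcg hθ₀ Cs
  obtain ⟨q₁, hq, k, hkk, hk1, hS3⟩ := h3 N δ ρ K Λ a b cnd η Rw Rb cg θ₀ KA hN hδ hρ ha hη hRw hRb hcg hθ₀ Cs κ C₂ q₀ k₀'
  obtain ⟨Cr, Γa, hS1'⟩ := hS1 q₁ k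
  obtain ⟨Γb, hS2'⟩ := hS2 q₁ hq k hkk hk1 Cr
  obtain ⟨Γc, hS3'⟩ := hS3 Cr
  refine ⟨max Γa (max Γb Γc), ?_⟩
  intro Γ hΓ γ α X w c m n Aa u v A T D hu hv hA hT hD hcl
  have hΓa : Γa ≤ Γ := le_trans (le_max_left _ _) hΓ
  have hΓb : Γb ≤ Γ := le_trans (le_trans (le_max_left _ _) (le_max_right _ _)) hΓ
  have hΓc : Γc ≤ Γ := le_trans (le_trans (le_max_right _ _) (le_max_right _ _)) hΓ
  obtain ⟨α0, β₀, U0, P0, Z, g, G, r, hfam⟩ := hS1' Γ hΓa γ α X w c m n Aa u v A T D hu hv hA hT hD hcl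
  obtain ⟨𝓚, 𝓠, 𝓫, 𝓬, hgate⟩ := hS2' Γ hΓb γ α X w c m n Aa u v A T D hu hv hA hT hD hcl α0 β₀ U0 P0 Z g G r hfam
  exact hS3' Γ hΓc γ α X w c m n Aa u v A T D hu hv hA hT hD hcl α0 β₀ U0 P0 Z g G r hfam 𝓚 𝓠 𝓫 𝓬 hgate

/-- CERTIFICATE: the filed route decl `TransverseReduction1ARmod` (stmt-23920, rev 61) unfolds to the line-side cut form by `Iff.rfl`. -/
theorem transverseReduction1ARmod_iff : TransverseReduction1ARmod ↔ CutFormMod :=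
  Iff.rfl

/-- **The skeleton (A12 shape): the item BY NAME from the registered stubs.** -/
theorem TransverseReduction1ARmod_of : TransverseReduction1ARmod :=
  transverseReduction1ARmod_iff.mpr
    (lineGlueMod stub_defectFamilyMod (stub_gateAssemblyLocMod stub_waistColumnGateLoc1A) stub_defectClosingMod)

end Summit.NavierStokesRegularity.NavierStokesRegularity.Cruxes.TransverseReduction1ARmod.DefectColumnGate

end
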